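import Summits.AtomisticToContinuum.Crystallization.Theorems.ChartedZeroExcessLayeredLatticeLiouvilleZI
import Summits.AtomisticToContinuum.Crystallization.Theorems.ChartedZeroExcessLayeredLatticeLiouvilleZF

/-!
# Part ZJ «ChartPinning / LinearChart» (lens-2 g78, NODE 78 — part 1 of 2; the junction is `…LatticeLiouvilleZK`)

NODE 78 cuts (GL) `BondLabelP` (NODE 77, tree `…ZC`) at the TYPED JUNCTION asked for by critic row 1388 (ii):

  (GL) ⟸ (L4-comb) `comb_extension` [PROVED, `…ZI`] ∧ (L2-S) `DoorChartPinningP` ∧ (L2-C) `CoolShadowLinearChartP`   (`…ZK`, PROVED).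

This file types the two open pieces.  Both are stated under the binders of (GL) VERBATIM, followed by `∀ Ψ τ`, a GLOBAL Barlow bond chart of `S`
(exists: `exists_globalChart_of_isCharted`, from `IsCharted (μS S)`), and carry extra parameters (radii `R₀ Rp R₁ RC`, wiggle `η`; record
`14, 57/4, 82/5, 33/2, 1/100`).  `Ψ` is ARBITRARY among exact charts, but on the registered shell it is a graph isomorphism onto a piece of the
contact graph of the perfect crystal `C`, so its site links are cuboctahedron / anticuboctahedron isomorphisms — all geometric: Ψ's cool sheets there
are PLANAR close-packed nets of `C` (a fold along a lattice row is not a link isomorphism).  This is what makes the case analyses below exhaustive.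

* (L2-S) `DoorChartPinningP … R₀ Rp R₁` — THE COOL COORDINATES NEAR `K` ARE PINNED.  In S-chart coordinates let `R` = cool zone atoms within `R₁` of
  `x₀` (the domain of the shell map), `P ⊆ R` those within `Rp` (pins required), `B ⊆ P` those within `R₀` (betweenness anchors), `I` = the inner
  atoms `coreOf S K r`.  Asserted (`IsPinningDatum`): sheets `kLo … kHi` strictly enclosing `I`, a base centre with closed star in `R` on each, every
  `P`-site of those sheets `Pinned` (certificate calculus of `…ZI`: reachable stars | rhombus | capAbove | capBelow), a `Weld` between consecutive
  sheets, every inner site BETWEEN two `B`-sites on a lattice line of its sheet, and Barlow neighbours of inner sites inner or in `P`.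
  PURELY about WHERE the atoms of the door set lie in their own chart: no label, no target crystal enters except through the binders.
  [WEAKER than (GL) in kind: produces no map into `C`; decidable per configuration by SATURATION of four rules · NOT (GL) reworded · UNDECIDED ·
  TRUE-leaning: above (below) the height range of `K ⊆ B̄(x₀,4)` the in-sheet cross-sections of the inner balls `B̄(k,r)` are NESTED and shrink
  outward, so pockets and channels (cool sites enclosed by / squeezed between inner discs — they exist, e.g. `K` a ring of radius `4`, sheet at height
  `≈ 7.9`: cool pocket of radius `≈ 2.7` inside an inner annulus) are capped from the next sheet out, which is star-pinned; between the heights of two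
  `K`-atoms their discs (radii `> 6.9`, centres `< 8` apart) overlap, so no channel; rims need nothing (`Rp < R₁`: pins are required only `2.15` inside
  the coordinate domain) · INSTRUMENTABLE «Row-P»: saturate the four rules on the perfect stacking's sites in `B̄(x₀,R₁)` per letter word and inner-region
  shape · why it might fail: a cool site within `Rp`, all six rhombi and both cap triangles meeting inner sites, not star-reachable — then ENLARGE THE
  RULE SET (any rigid sub-configuration forces; `…ZI` is modular), not the thesis · leaf: M (finite geometry of balls ∩ Barlow stackings).]
* (L2-C) `CoolShadowLinearChartP … R₁ RC η` — THE COOL SHADOW CRYSTAL CARRIES AN S-ADAPTED ALMOST-LINEAR BARLOW BOND CHART NEAR `x₀`: a chart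
  `Ψ' : ℤ × ℤ × ℤ → E3`, origins `o : ℤ → E3`, ONE in-plane basis `b₁ b₂`, letters `τ'`, such that `Ψ'` is a Barlow bond chart of `C` on the
  coordinate ball `D = {y | dist (Ψ' y) x₀ ≤ RC}`, COVERS `C ∩ B̄(x₀,RC)`, is SHEET-COMPATIBLE with `Ψ` (a cool `S`-atom within `R₁` of `x₀` and a
  `D`-site within `ε` of it have the same sheet index), and stays within `η` of its LINEAR SKELETON `linChart o b₁ b₂ (k,(i,j)) = o k + i•b₁ + j•b₂`
  EVERYWHERE (off the charted region the prover may put `Ψ' :=` the skeleton).  `η` (record `1/100`) absorbs the registry wiggle of `C`: its layers are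
  exact translates `L'(Λ) + w' m`, but the inter-layer shifts are only `ϑr`-ideal (shadow clause), so a chart whose sheets run TRANSVERSALLY through
  `C`'s layers is linear only up to the accumulated shifts (`≲ 40·10⁻⁴` across the ball); an exactly linear transverse chart would be REFUTABLE
  (take `S` = fcc, `C` = `S` re-layered obliquely with `10⁻⁵` shifts — admissible for `IsCoolShadowCrystal`).
  [WEAKER than (GL): concerns the PERFECT crystal `C = placedCrystal L' w' U t` and the `ε`-registration only — no extension, no inner atom · EXISTENTIAL
  in the chart (orientation / origins / letters free, so `k ↦ -k` and re-indexing are available to the prover) · UNDECIDED · TRUE-leaning by the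
  dichotomy PARALLEL (C's layers parallel to Ψ's sheets near `x₀`: `Ψ'` = the `LayeredHom` parametrisation itself, re-indexed along the registration —
  consecutive S-sheets register into distinct consecutive C-layers since `ε = 10⁻⁴ ≪` the layer gap; `η = 0`) / OBLIQUE (Ψ's cool sheets, `ε`-registered
  into `C` on the thick shell `rI < d_K < ℓ` by REG-in/REG-out, put transverse close-packed planes through every C-layer meeting `B̄(x₀,RC)` — each meets
  the shell `14 < d_{x₀} < 17.5` in a disc of radius `≥ 5.8`; a Barlow stacking has non-basal close-packed planes only across `c`-letters, so `C` is
  fcc-TYPE on the ball and `Ψ'` slices it along the family parallel to Ψ's sheets: skeleton `o k = o 0 + k • n`, constant letter, wiggle `≤ η`) · why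
  it might fail: the oblique case needs the transverse patch inside EVERY layer pair meeting the `RC`-ball to force the letter (radius `≥ 5.8` vs the
  `2`-site pattern that decides `h/c`: ample but unformalised), and the accumulated wiggle `≤ η` (needs the shadow clause's `ϑr` per layer × `≤ 42`
  layers `≤ 1/100`: holds with factor `2`) · INSTRUMENTABLE «Row-L» (letter words of length `≤ 42` × relative orientations) · leaf: M.]

Also here: `linChart` and its affinity along lattice lines, `loRot_zsmul`, the betweenness inequality `dist_le_of_between` (a point on a segment is
no farther from `x₀` than the ends — the convexity that REPLACES every metric container of g77's abandoned designs), and the coordinate regions.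
0 sorry; standard axioms.
-/

noncomputable section
open scoped BigOperators Classical InnerProductSpace RealInnerProductSpace
open MeasureTheory Set Metric Filter Topology
open Summit.AtomisticToContinuum.Crystallization.Theorems.ChartedPlanarOrderRigidityDoor (E3 IsClean IsCharted)
open Summit.AtomisticToContinuum.Crystallization.Theorems.ChartedPlanarOrderDensityDichotomy (μS IsSep)
open Summit.AtomisticToContinuum.Crystallization.Theorems.ChartedPlanarOrderCleanScaleP (IsCleanP IsDoorSetP)
open Summit.AtomisticToContinuum.Crystallization.Theorems.ChartedPlanarOrderMesoCut (LayeredHom EnvClose)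
open Summit.AtomisticToContinuum.Crystallization.Theorems.ChartedPlanarOrderDoorLayeredOsc (IsTwoShellAffineGood mem_iff_μS_singleton_ne_zero)
open Literature.MathematicalPhysics.StatisticalMechanics (lennardJones IsHaggSeq barlowPos barlowStacking barlowPos_mem
  mem_barlowStacking_iff)

namespace Summit.AtomisticToContinuum.Crystallization.Theorems.ChartedZeroExcessLayeredLatticeLiouville

/-! ### ZJ-1  Global charts, linear charts, betweenness -/

/-- ★ a charted set has a GLOBAL Barlow bond chart that is ONTO `S` (tree ZH's chart plus the surjectivity of `IsCharted`'s bijection). -/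
theorem exists_globalChart_of_isCharted {S : Set E3} (h : IsCharted (μS S)) :
    ∃ (Ψ : ℤ × ℤ × ℤ → E3) (τ : ℤ → Bool), IsBarlowBondChart S Set.univ Ψ τ ∧ ∀ p ∈ S, ∃ x, Ψ x = p := by
  obtain ⟨s, hs, Φ, hbij, hΦ⟩ := h
  have hS : {p : E3 | μS S {p} ≠ 0} = S := Set.ext fun p => mem_iff_μS_singleton_ne_zero S p
  rw [hS] at hbij
  refine ⟨_, _, isBarlowBondChart_of_chart hs hbij (fun p hp q hq => hΦ p hp q hq), fun p hp => ?_⟩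
  obtain ⟨y, hy, hyp⟩ := hbij.surjOn hp
  obtain ⟨k, i, j, rfl⟩ := mem_barlowStacking_iff.1 hy
  exact ⟨(k, i, j), hyp⟩

/-- **linear chart**: sheet origins `o k`, ONE in-plane basis `b₁ b₂` for all sheets. -/
def linChart (o : ℤ → E3) (b₁ b₂ : E3) (y : ℤ × ℤ × ℤ) : E3 := o y.1 + (y.2.1 : ℝ) • b₁ + (y.2.2 : ℝ) • b₂

/-- a linear chart is affine along every lattice line of a sheet. [formal bookkeeping] -/
theorem linChart_add_zsmul (o : ℤ → E3) (b₁ b₂ : E3) (k : ℤ) (u v : ℤ × ℤ) (n : ℤ) :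
    linChart o b₁ b₂ (k, u + n • v) = linChart o b₁ b₂ (k, u) + (n : ℝ) • (((v.1 : ℤ) : ℝ) • b₁ + ((v.2 : ℤ) : ℝ) • b₂) := by
  simp only [linChart, Prod.fst_add, Prod.snd_add, Prod.smul_fst, Prod.smul_snd, smul_eq_mul, Int.cast_add, Int.cast_mul,
    add_smul, mul_smul, smul_add]
  abel

/-- the point-group maps commute with integer scaling. [formal bookkeeping] -/
theorem loRot_zsmul (j : Fin 6) (ε : Bool) (n : ℤ) (p : ℤ × ℤ) : loRot j ε (n • p) = n • loRot j ε p := by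
  simp only [loRot, Prod.smul_fst, Prod.smul_snd, smul_eq_mul, Prod.ext_iff]
  constructor <;> ring

/-- ★ **BETWEENNESS**: a point of the segment between two points of the closed ball `B̄(x₀,ρ)` lies in that ball. -/
theorem dist_le_of_between {P x₀ V : E3} {n₁ n₂ ρ : ℝ} (h₁ : 0 < n₁) (h₂ : 0 < n₂)
    (d₁ : dist (P + n₁ • V) x₀ ≤ ρ) (d₂ : dist (P + (-n₂) • V) x₀ ≤ ρ) : dist P x₀ ≤ ρ := by
  rw [dist_eq_norm] at d₁ d₂ ⊢
  have e : (n₁ + n₂) • (P - x₀) = n₂ • (P + n₁ • V - x₀) + n₁ • (P + (-n₂) • V - x₀) := by module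
  have h := norm_add_le (n₂ • (P + n₁ • V - x₀)) (n₁ • (P + (-n₂) • V - x₀))
  rw [← e, norm_smul, norm_smul, norm_smul, Real.norm_of_nonneg (by linarith : (0 : ℝ) ≤ n₁ + n₂),
    Real.norm_of_nonneg h₂.le, Real.norm_of_nonneg h₁.le] at h
  nlinarith [mul_le_mul_of_nonneg_left d₁ h₂.le, mul_le_mul_of_nonneg_left d₂ h₁.le, norm_nonneg (P - x₀)]

/-! ### ZJ-2  Coordinate regions and the pinning datum -/

/-- chart coordinates of the COOL zone atoms (`moatIn S K r ℓ`) within `ρ` of `x₀`. -/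
def zoneCoords (Ψ : ℤ × ℤ × ℤ → E3) (S K : Set E3) (r ℓ ρ : ℝ) (x₀ : E3) : Set (ℤ × ℤ × ℤ) :=
  {x | Ψ x ∈ moatIn S K r ℓ ∧ dist (Ψ x) x₀ ≤ ρ}

/-- chart coordinates of the INNER atoms (`coreOf S K r`). -/
def coreCoords (Ψ : ℤ × ℤ × ℤ → E3) (S K : Set E3) (r : ℝ) : Set (ℤ × ℤ × ℤ) := {x | Ψ x ∈ coreOf S K r}

/-- the zone coordinate regions grow with the radius. [formal bookkeeping] -/
theorem zoneCoords_mono (Ψ : ℤ × ℤ × ℤ → E3) (S K : Set E3) (r ℓ : ℝ) {ρ ρ' : ℝ} (x₀ : E3) (h : ρ ≤ ρ') :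
    zoneCoords Ψ S K r ℓ ρ x₀ ⊆ zoneCoords Ψ S K r ℓ ρ' x₀ := fun _ hx => ⟨hx.1, hx.2.trans h⟩

/-- **pinning datum** for letters `τ`, domain `R`, pin region `P`, anchor region `B`, inner region `I` (all ⊆ ℤ × ℤ × ℤ): sheets `kLo … kHi`
strictly enclosing `I`; a base centre with closed star in `R` on each; every `P`-site of these sheets `Pinned τ R base kLo kHi` (`…ZI`); a `Weld`
between consecutive sheets; every inner site strictly BETWEEN two `B`-sites on a lattice line of its sheet; Barlow neighbours of inner sites are
inner or in `P`. -/
def IsPinningDatum (τ : ℤ → Bool) (R P B I : Set (ℤ × ℤ × ℤ)) : Prop :=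
  ∃ (kLo kHi : ℤ) (base : ℤ → ℤ × ℤ),
    (∀ x ∈ I, kLo < x.1 ∧ x.1 < kHi) ∧
    (∀ k, kLo ≤ k → k ≤ kHi → loStar (base k) ⊆ slice R k) ∧
    (∀ x ∈ P, kLo ≤ x.1 → x.1 ≤ kHi → Pinned τ R base kLo kHi x) ∧
    (∀ k, kLo ≤ k → k < kHi → Weld τ R base kLo kHi k) ∧
    (∀ x ∈ I, ∃ (m : Fin 6) (n₁ n₂ : ℤ), 0 < n₁ ∧ 0 < n₂ ∧
      (x.1, x.2 + n₁ • loDir m) ∈ B ∧ (x.1, x.2 + (-n₂) • loDir m) ∈ B) ∧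
    (∀ x ∈ I, ∀ y, BarlowAdj τ x y → y ∈ I ∨ y ∈ P)

/-! ### ZJ-3  The two typed pieces of NODE 78 -/

/-- ★★★ **(L2-S) «DoorChartPinningP ϑc ϑp r q rsh rm σ ϑr Rs ε rI ℓ aHi Λ θ s R₀ Rp R₁» — THE COOL COORDINATES NEAR `K` ARE PINNED.**  Under the
binders of (GL) `BondLabelP` verbatim and for every global Barlow bond chart `Ψ, τ` of `S` onto `S`: the pinning datum of ZJ-2 for
`R, P, B` = the cool zone atoms within `R₁, Rp, R₀` of `x₀` and `I` = the inner atoms `coreOf S K r`, in `Ψ`-coordinates.  See the module docstring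
for the tags [WEAKER than (GL) in kind · UNDECIDED · TRUE-leaning · INSTRUMENTABLE «Row-P» · why it might fail · leaf M]. -/
def DoorChartPinningP (ϑc ϑp r q rsh rm σ ϑr Rs ε rI ℓ aHi Λ θ s R₀ Rp R₁ : ℝ) : Prop :=
  ∀ δ : ℝ, 0 < δ → ∀ a : ℝ, 0 < a →
    ∀ S : Set E3, IsDoorSetP aHi δ S → (∀ z : E3, Summable fun y : S => lennardJones (dist z (y : E3))) →
      (∀ p ∈ S, IsTwoShellAffineGood θ S p) →
        ∀ (L : E3 ≃L[ℝ] E3) (w : ℤ → E3), IsEquilChart a s Λ L w →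
          ∀ (x₀ : E3) (K : Set E3), K ⊆ S → (∀ k ∈ K, dist k x₀ ≤ q) →
            IsTameOn ϑp S (LayeredHom (L : E3 →L[ℝ] E3) w) (coreOf S K rm) →
              IsTameOn ϑc S (LayeredHom (L : E3 →L[ℝ] E3) w) (moatIn S K r (r + rsh)) →
                ∀ (L' : E3 →L[ℝ] E3) (w' : ℤ → E3) (U : E3 ≃ₗᵢ[ℝ] E3) (t : E3),
                  IsCoolShadowCrystal σ ϑr Rs ε r rI ℓ S K (LayeredHom (L : E3 →L[ℝ] E3) w) L' w' U t →
                    ∀ (Ψ : ℤ × ℤ × ℤ → E3) (τ : ℤ → Bool), IsBarlowBondChart S Set.univ Ψ τ → (∀ p ∈ S, ∃ x, Ψ x = p) →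
                      IsPinningDatum τ (zoneCoords Ψ S K r ℓ R₁ x₀) (zoneCoords Ψ S K r ℓ Rp x₀) (zoneCoords Ψ S K r ℓ R₀ x₀)
                        (coreCoords Ψ S K r)

/-- ★★★ **(L2-C) «CoolShadowLinearChartP ϑc ϑp r q rsh rm σ ϑr Rs ε rI ℓ aHi Λ θ s R₁ RC η» — THE COOL SHADOW CRYSTAL CARRIES AN S-ADAPTED
ALMOST-LINEAR BARLOW BOND CHART NEAR `x₀`.**  Under the binders of (GL) verbatim and for every global Barlow bond chart `Ψ, τ` of `S` onto `S`: a chart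
`Ψ'`, origins `o`, one in-plane basis `b₁ b₂` and letters `τ'` such that `Ψ'` is a Barlow bond chart of `C = placedCrystal L' w' U t` on the coordinate
ball `{y | dist (Ψ' y) x₀ ≤ RC}`, covers `C ∩ B̄(x₀, RC)`, is sheet-compatible with `Ψ` on the cool zone atoms within `R₁` of `x₀`, and is everywhere
within `η` of the linear skeleton `linChart o b₁ b₂`.  See the module docstring for the tags [WEAKER than (GL) · EXISTENTIAL chart · UNDECIDED ·
TRUE-leaning (parallel / oblique dichotomy) · why it might fail · INSTRUMENTABLE «Row-L» · leaf M]. -/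
def CoolShadowLinearChartP (ϑc ϑp r q rsh rm σ ϑr Rs ε rI ℓ aHi Λ θ s R₁ RC η : ℝ) : Prop :=
  ∀ δ : ℝ, 0 < δ → ∀ a : ℝ, 0 < a →
    ∀ S : Set E3, IsDoorSetP aHi δ S → (∀ z : E3, Summable fun y : S => lennardJones (dist z (y : E3))) →
      (∀ p ∈ S, IsTwoShellAffineGood θ S p) →
        ∀ (L : E3 ≃L[ℝ] E3) (w : ℤ → E3), IsEquilChart a s Λ L w →
          ∀ (x₀ : E3) (K : Set E3), K ⊆ S → (∀ k ∈ K, dist k x₀ ≤ q) →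
            IsTameOn ϑp S (LayeredHom (L : E3 →L[ℝ] E3) w) (coreOf S K rm) →
              IsTameOn ϑc S (LayeredHom (L : E3 →L[ℝ] E3) w) (moatIn S K r (r + rsh)) →
                ∀ (L' : E3 →L[ℝ] E3) (w' : ℤ → E3) (U : E3 ≃ₗᵢ[ℝ] E3) (t : E3),
                  IsCoolShadowCrystal σ ϑr Rs ε r rI ℓ S K (LayeredHom (L : E3 →L[ℝ] E3) w) L' w' U t →
                    ∀ (Ψ : ℤ × ℤ × ℤ → E3) (τ : ℤ → Bool), IsBarlowBondChart S Set.univ Ψ τ → (∀ p ∈ S, ∃ x, Ψ x = p) →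
                      ∃ (Ψ' : ℤ × ℤ × ℤ → E3) (o : ℤ → E3) (b₁ b₂ : E3) (τ' : ℤ → Bool),
                        IsBarlowBondChart (placedCrystal L' w' U t) {y | dist (Ψ' y) x₀ ≤ RC} Ψ' τ' ∧
                        (∀ c ∈ placedCrystal L' w' U t, dist c x₀ ≤ RC → ∃ y, Ψ' y = c) ∧
                        (∀ x, Ψ x ∈ moatIn S K r ℓ → dist (Ψ x) x₀ ≤ R₁ →
                          ∀ y, dist (Ψ' y) x₀ ≤ RC → dist (Ψ x) (Ψ' y) ≤ ε → y.1 = x.1) ∧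
                        (∀ y, dist (Ψ' y) (linChart o b₁ b₂ y) ≤ η)

end Summit.AtomisticToContinuum.Crystallization.Theorems.ChartedZeroExcessLayeredLatticeLiouville
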